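import Summits.ValiantsHypothesis.ValiantsHypothesis.Theorems.SOSTauSOSTauStubRobustOfGaussPair

/-!
# Crux `SOSTau.SOSTau` (stmt-ValiantsHypothesis-18748), line `Sketch` — stub `stub_robustGen`:
the Gaussian-pair inequalities at every ratio imply the robust-excursion count at every threshold

For a real weighted sum of sparse squares `F = Σᵢ aᵢ gᵢ²` with majorant `M = Σᵢ |aᵢ| gᵢ²`, positive
zeros `0 < z₀ < z₁ < ⋯ < z_N` of `F`, a threshold `η ∈ (0, 1)` and a set `K` of indices `k` whose
excursion `(z_k, z_{k+1})` contains an `η`-ROBUST point `t` (`η M(t) < |F(t)|`), we prove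
`|K| ≤ C · S`, `S = Σᵢ |supp gᵢ|`, with `C = ⌈2/κ⌉₊ + 1`, where `κ` is the constant of the
Gaussian-pair hypothesis (stub `stub_gaussPairGen` of the line, assumed here as the antecedent) at
the ratio `λ = (1 + η)/(1 - η) > 1`.  This is the landed threshold-`1/2`, ratio-`3` instance
`stub_robustOfGaussPair` (file `SOSTauSOSTauStubRobustOfGaussPair`) run verbatim at a general
threshold: the ratio-free lemmas of that file (`card_pos_roots_mul_linComb_le`,
`card_le_card_pos_roots_of_sign_changes`, `sum_measureReal_le_of_card_filter_le`,
`le_measureReal_of_inter_subset`, `inner_toLp_right`, `norm_sq_toLp`) are imported, and the two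
lemmas that hard-code the ratio `3` / the threshold `1/2` (`le_measureReal_signChange`,
`card_mul_le_of_good`) are re-proved below in general form (suffix `Gen`).

Proof.  Write `aᵢ = uᵢ² - vᵢ²`, `|aᵢ| = uᵢ² + vᵢ²`, `uᵢvᵢ = 0`, and lift `x` to the two blocks
`U_x = (uᵢ gᵢ(x))ᵢ`, `V_x = (vᵢ gᵢ(x))ᵢ` of `ℝˢ`: `⟪U_x, V_x⟫ = 0`, `‖U_x‖² - ‖V_x‖² = F(x)`,
`‖U_x‖² + ‖V_x‖² = M(x)`.  At an `η`-robust point with, say, `F(t) > 0` one has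
`η (‖U_t‖² + ‖V_t‖²) < ‖U_t‖² - ‖V_t‖²`, i.e. `(1 + η) ‖V_t‖² < (1 - η) ‖U_t‖²`, i.e. the positive
block dominates by the ratio `λ`: `λ ‖V_t‖² ≤ ‖U_t‖²` (and symmetrically when `F(t) < 0`).  For a
standard Gaussian `c ∈ ℝˢ` the section `D_c(x) = ⟪c, U_x⟫² - ⟪c, V_x⟫²` is the polynomial
`(L₊ - L₋)(L₊ + L₋)`, `L± = Σᵢ cᵢ uᵢ gᵢ` resp. `Σᵢ cᵢ vᵢ gᵢ`, a product of two linear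
combinations of the `gᵢ`, so it has `≤ 2S` distinct positive zeros (sparse Descartes).  GOOD
indices (`M(z_k) > 0`): at `z_k`, `‖U‖ = ‖V‖ > 0`, so `D_c(z_k)` has either sign with
probability `≥ 1/2`; at the robust point the dominant sign has probability `≥ 1/2 + κ`; hence `D_c`
changes sign on `(z_k, t_k)` with probability `≥ κ` (inclusion–exclusion), while for every fixed
`c` this happens for at most `2S` indices (intermediate value theorem on the disjoint intervals
`(z_k, t_k)`); integrating the counting function gives `κ · #good ≤ 2S`.  BAD indices
(`M(z_k) = 0`): `z_k` is a positive zero of a fixed `g_{i₀}` with `a_{i₀} ≠ 0`, `g_{i₀} ≠ 0`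
(which exists since `F ≠ 0` once `K ≠ ∅`), so `#bad < |supp g_{i₀}| ≤ S`. [folklore]
-/

noncomputable section

-- `Summit.ValiantsHypothesis.ValiantsHypothesis.…` is the tree's mandated layout (Sub = Summit).
set_option linter.dupNamespace false

namespace Summit.ValiantsHypothesis.ValiantsHypothesis.Theorems.SOSTauSOSTau

open Polynomial MeasureTheory ProbabilityTheory Finset
open Literature.Computability.AlgebraicComplexity

/-! ### From `η`-robustness to dominance by the ratio `(1 + η)/(1 - η)` -/

/-- At an `η`-robust point (`η < 1`) where the block of squared norm `P` dominates the block of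
squared norm `Q`, `η (P + Q) < P - Q` gives `(1 + η)/(1 - η) · Q ≤ P`. [folklore] -/
theorem ratio_mul_le_of_robustGen {η P Q : ℝ} (hη1 : η < 1) (h : η * (P + Q) < P - Q) :
    (1 + η) / (1 - η) * Q ≤ P := by
  rw [div_mul_eq_mul_div, div_le_iff₀ (sub_pos.mpr hη1)]
  linarith

/-- The ratio `(1 + η)/(1 - η)` exceeds `1` for `0 < η < 1`. [folklore] -/
theorem one_lt_ratioGen {η : ℝ} (hη0 : 0 < η) (hη1 : η < 1) : 1 < (1 + η) / (1 - η) := by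
  rw [one_lt_div (sub_pos.mpr hη1)]
  linarith

/-! ### Probability of one sign change -/

/-- **One `η`-robust excursion costs probability `κ`.**  For orthogonal pairs `(U₀, V₀)` (at the
zero: `‖U₀‖ = ‖V₀‖ > 0`) and `(U₁, V₁)` (at the `η`-robust point:
`η (‖U₁‖² + ‖V₁‖²) < |‖U₁‖² - ‖V₁‖²|`, `0 ≤ η < 1`), the Gaussian sign-change event
`{c | (⟪c,U₀⟫² - ⟪c,V₀⟫²) · (⟪c,U₁⟫² - ⟪c,V₁⟫²) < 0}` has probability at least `κ`, granted the
Gaussian-pair inequalities at the ratio `(1 + η)/(1 - η)`. [folklore] -/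
theorem le_measureReal_signChangeGen {κ η : ℝ} {n : ℕ} (hη0 : 0 ≤ η) (hη1 : η < 1)
    (hG : ∀ (U V : EuclideanSpace ℝ (Fin n)), inner ℝ U V = 0 → 0 < ‖U‖ →
      (‖U‖ = ‖V‖ →
        (1 / 2 : ℝ) ≤ (stdGaussian (EuclideanSpace ℝ (Fin n))).real
          {c | inner ℝ c U ^ 2 < inner ℝ c V ^ 2}) ∧
      ((1 + η) / (1 - η) * ‖V‖ ^ 2 ≤ ‖U‖ ^ 2 →
        1 / 2 + κ ≤ (stdGaussian (EuclideanSpace ℝ (Fin n))).real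
          {c | inner ℝ c V ^ 2 < inner ℝ c U ^ 2}))
    (U₀ V₀ U₁ V₁ : EuclideanSpace ℝ (Fin n)) (h₀ : inner ℝ U₀ V₀ = 0) (h₁ : inner ℝ U₁ V₁ = 0)
    (heq : ‖U₀‖ = ‖V₀‖) (hpos : 0 < ‖U₀‖)
    (hrob : η * (‖U₁‖ ^ 2 + ‖V₁‖ ^ 2) < |‖U₁‖ ^ 2 - ‖V₁‖ ^ 2|) :
    κ ≤ (stdGaussian (EuclideanSpace ℝ (Fin n))).real
      {c | (inner ℝ c U₀ ^ 2 - inner ℝ c V₀ ^ 2) * (inner ℝ c U₁ ^ 2 - inner ℝ c V₁ ^ 2) < 0} := by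
  have hV₀ : 0 < ‖V₀‖ := heq ▸ hpos
  have h₀' : inner ℝ V₀ U₀ = 0 := by rw [real_inner_comm]; exact h₀
  have h₁' : inner ℝ V₁ U₁ = 0 := by rw [real_inner_comm]; exact h₁
  have hmeas : ∀ X Y : EuclideanSpace ℝ (Fin n),
      MeasurableSet {c : EuclideanSpace ℝ (Fin n) | inner ℝ c X ^ 2 < inner ℝ c Y ^ 2} :=
    fun X Y => measurableSet_lt (by fun_prop) (by fun_prop)
  rcases lt_trichotomy (‖U₁‖ ^ 2 - ‖V₁‖ ^ 2) 0 with hlt | heq0 | hgt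
  · -- the negative block dominates at the robust point: sign pattern `+` then `-`
    rw [abs_of_neg hlt] at hrob
    have hV₁ : 0 < ‖V₁‖ := norm_pos_iff.mpr fun h0 => by
      rw [h0, norm_zero] at hlt
      nlinarith [sq_nonneg ‖U₁‖]
    refine le_measureReal_of_inter_subset _ (hmeas _ _) ((hG V₀ U₀ h₀' hV₀).1 heq.symm)
      ((hG V₁ U₁ h₁' hV₁).2 (ratio_mul_le_of_robustGen hη1 (by linarith))) fun c hc => ?_
    simp only [Set.mem_inter_iff, Set.mem_setOf_eq] at hc ⊢
    exact mul_neg_of_pos_of_neg (sub_pos.mpr hc.1) (sub_neg.mpr hc.2)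
  · exfalso
    rw [heq0, abs_zero] at hrob
    have : 0 ≤ η * (‖U₁‖ ^ 2 + ‖V₁‖ ^ 2) := mul_nonneg hη0 (by positivity)
    linarith
  · -- the positive block dominates at the robust point: sign pattern `-` then `+`
    rw [abs_of_pos hgt] at hrob
    have hU₁ : 0 < ‖U₁‖ := norm_pos_iff.mpr fun h0 => by
      rw [h0, norm_zero] at hgt
      nlinarith [sq_nonneg ‖V₁‖]
    refine le_measureReal_of_inter_subset _ (hmeas _ _) ((hG U₀ V₀ h₀ hpos).1 heq)
      ((hG U₁ V₁ h₁ hU₁).2 (ratio_mul_le_of_robustGen hη1 hrob)) fun c hc => ?_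
    simp only [Set.mem_inter_iff, Set.mem_setOf_eq] at hc ⊢
    exact mul_neg_of_neg_of_pos (sub_neg.mpr hc.1) (sub_pos.mpr hc.2)

/-! ### The lifted sparse curve and the robust count at threshold `η` -/

/-- **`η`-robust excursions at good zeros cost `κ` each, and a Gaussian section pays at most
`2S`.**  For `F = Σ aᵢgᵢ²`, `M = Σ|aᵢ|gᵢ²`, positive zeros `z₀ < ⋯ < z_N` of `F`, `0 ≤ η < 1`, and
a set `T` of indices `k` with an `η`-robust point `t_k ∈ (z_k, z_{k+1})` (`η M(t_k) < |F(t_k)|`)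
and `M(z_k) > 0`: `|T| · κ ≤ 2 Σ|supp gᵢ|`, granted the Gaussian-pair inequalities at the ratio
`(1 + η)/(1 - η)`.  Lift to `U_x = (uᵢ gᵢ(x))ᵢ`, `V_x = (vᵢ gᵢ(x))ᵢ` (`uᵢ² - vᵢ² = aᵢ`,
`uᵢvᵢ = 0`); the event "`⟪c,U_x⟫² - ⟪c,V_x⟫²` changes sign between `z_k` and `t_k`" has
probability `≥ κ` (`le_measureReal_signChangeGen`), while for every `c` it happens for at most
`2S` indices (`card_le_card_pos_roots_of_sign_changes`, `card_pos_roots_mul_linComb_le`);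
integrate (`sum_measureReal_le_of_card_filter_le`). [folklore] -/
theorem card_mul_le_of_goodGen {κ η : ℝ} (hη0 : 0 ≤ η) (hη1 : η < 1)
    (hG : ∀ (n : ℕ) (U V : EuclideanSpace ℝ (Fin n)), inner ℝ U V = 0 → 0 < ‖U‖ →
      (‖U‖ = ‖V‖ →
        (1 / 2 : ℝ) ≤ (stdGaussian (EuclideanSpace ℝ (Fin n))).real
          {c | inner ℝ c U ^ 2 < inner ℝ c V ^ 2}) ∧
      ((1 + η) / (1 - η) * ‖V‖ ^ 2 ≤ ‖U‖ ^ 2 →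
        1 / 2 + κ ≤ (stdGaussian (EuclideanSpace ℝ (Fin n))).real
          {c | inner ℝ c V ^ 2 < inner ℝ c U ^ 2}))
    {s : ℕ} (a : Fin s → ℝ) (g : Fin s → ℝ[X]) {N : ℕ} (z : Fin (N + 1) → ℝ) (hz : StrictMono z)
    (hz0 : 0 < z 0) (hroot : ∀ k, (∑ i, C (a i) * g i ^ 2).eval (z k) = 0) (t : Fin N → ℝ)
    (T : Finset (Fin N))
    (hT : ∀ k ∈ T, z k.castSucc < t k ∧ t k < z k.succ ∧
      η * (∑ i, C (|a i|) * g i ^ 2).eval (t k) < |(∑ i, C (a i) * g i ^ 2).eval (t k)| ∧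
      0 < (∑ i, C (|a i|) * g i ^ 2).eval (z k.castSucc)) :
    (T.card : ℝ) * κ ≤ 2 * ∑ i, (g i).support.card := by
  classical
  -- square roots of the positive and of the negative parts of the weights
  obtain ⟨u, v, huv, hsub, hadd⟩ : ∃ u v : Fin s → ℝ, (∀ i, u i * v i = 0) ∧
      (∀ i, u i ^ 2 - v i ^ 2 = a i) ∧ (∀ i, u i ^ 2 + v i ^ 2 = |a i|) := by
    refine ⟨fun i => if 0 ≤ a i then √(a i) else 0, fun i => if 0 ≤ a i then 0 else √(-a i),
      fun i => ?_, fun i => ?_, fun i => ?_⟩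
    · dsimp only
      split_ifs <;> simp
    · dsimp only
      split_ifs with h
      · rw [Real.sq_sqrt h]
        ring
      · rw [Real.sq_sqrt (by linarith)]
        ring
    · dsimp only
      split_ifs with h
      · rw [Real.sq_sqrt h, abs_of_nonneg h]
        ring
      · rw [Real.sq_sqrt (by linarith), abs_of_neg (not_le.mp h)]
        ring
  -- the lifted sparse curve: positive block `U`, negative block `V`
  obtain ⟨U, hU⟩ : ∃ U : ℝ → EuclideanSpace ℝ (Fin s),
      ∀ x, U x = WithLp.toLp 2 (fun i => u i * (g i).eval x) := ⟨_, fun _ => rfl⟩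
  obtain ⟨V, hV⟩ : ∃ V : ℝ → EuclideanSpace ℝ (Fin s),
      ∀ x, V x = WithLp.toLp 2 (fun i => v i * (g i).eval x) := ⟨_, fun _ => rfl⟩
  have hUV : ∀ x, inner ℝ (U x) (V x) = 0 := fun x => by
    rw [hU, hV, inner_toLp_right]
    exact Finset.sum_eq_zero fun i _ => by rw [PiLp.toLp_apply, mul_mul_mul_comm, huv, zero_mul]
  have hF : ∀ x, ‖U x‖ ^ 2 - ‖V x‖ ^ 2 = (∑ i, C (a i) * g i ^ 2).eval x := fun x => by
    rw [hU, hV, norm_sq_toLp, norm_sq_toLp, eval_finsetSum, ← Finset.sum_sub_distrib]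
    refine Finset.sum_congr rfl fun i _ => ?_
    rw [eval_mul, eval_C, eval_pow, mul_pow, mul_pow, ← sub_mul, hsub]
  have hM : ∀ x, ‖U x‖ ^ 2 + ‖V x‖ ^ 2 = (∑ i, C (|a i|) * g i ^ 2).eval x := fun x => by
    rw [hU, hV, norm_sq_toLp, norm_sq_toLp, eval_finsetSum, ← Finset.sum_add_distrib]
    refine Finset.sum_congr rfl fun i _ => ?_
    rw [eval_mul, eval_C, eval_pow, mul_pow, mul_pow, ← add_mul, hadd]
  -- the Gaussian section `⟪c, U_x⟫² - ⟪c, V_x⟫² = ((L₊ - L₋)(L₊ + L₋))(x)`, a sparse product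
  have hD : ∀ (c : EuclideanSpace ℝ (Fin s)) (x : ℝ),
      ((∑ i, C (c i * (u i - v i)) * g i) * ∑ i, C (c i * (u i + v i)) * g i).eval x =
        inner ℝ c (U x) ^ 2 - inner ℝ c (V x) ^ 2 := fun c x => by
    rw [hU, hV, inner_toLp_right, inner_toLp_right]
    simp only [eval_mul, eval_finsetSum, eval_C, mul_sub, mul_add, sub_mul, add_mul,
      Finset.sum_sub_distrib, Finset.sum_add_distrib, mul_assoc]
    ring
  -- the sign-change events `E_k = {c | D_c(z_k) · D_c(t_k) < 0}`
  obtain ⟨Ev, hEv⟩ : ∃ Ev : Fin N → Set (EuclideanSpace ℝ (Fin s)), ∀ k, Ev k =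
      {c | (inner ℝ c (U (z k.castSucc)) ^ 2 - inner ℝ c (V (z k.castSucc)) ^ 2) *
        (inner ℝ c (U (t k)) ^ 2 - inner ℝ c (V (t k)) ^ 2) < 0} := ⟨_, fun _ => rfl⟩
  have hmeas : ∀ k, MeasurableSet (Ev k) := fun k => by
    rw [hEv]
    exact measurableSet_lt (by fun_prop) measurable_const
  -- (i) every event is likely
  have h1 : ∀ k ∈ T, κ ≤ (stdGaussian (EuclideanSpace ℝ (Fin s))).real (Ev k) := by
    intro k hk
    obtain ⟨-, -, hrob, hgood⟩ := hT k hk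
    have heq : ‖U (z k.castSucc)‖ = ‖V (z k.castSucc)‖ := by
      have h := hF (z k.castSucc)
      rw [hroot] at h
      exact (sq_eq_sq₀ (norm_nonneg _) (norm_nonneg _)).mp (by linarith)
    have hpos : 0 < ‖U (z k.castSucc)‖ := norm_pos_iff.mpr fun h0 => by
      have h := hM (z k.castSucc)
      rw [← heq, h0, norm_zero] at h
      linarith
    have hrob' : η * (‖U (t k)‖ ^ 2 + ‖V (t k)‖ ^ 2) < |‖U (t k)‖ ^ 2 - ‖V (t k)‖ ^ 2| := by
      rw [hF, hM]
      exact hrob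
    rw [hEv]
    exact le_measureReal_signChangeGen hη0 hη1 (hG s) _ _ _ _ (hUV _) (hUV _) heq hpos hrob'
  -- (ii) every `c` lies in at most `2S` of the events
  have h2 : ∀ c : EuclideanSpace ℝ (Fin s),
      (T.filter (fun k => c ∈ Ev k)).card ≤ 2 * ∑ i, (g i).support.card := by
    intro c
    refine (card_le_card_pos_roots_of_sign_changes z hz hz0 t
      ((∑ i, C (c i * (u i - v i)) * g i) * ∑ i, C (c i * (u i + v i)) * g i)
      (T.filter (fun k => c ∈ Ev k)) fun k hk => ?_).trans (card_pos_roots_mul_linComb_le _ _ _)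
    rw [Finset.mem_filter, hEv, Set.mem_setOf_eq] at hk
    obtain ⟨hkT, hkE⟩ := hk
    obtain ⟨ht1, ht2, -, -⟩ := hT k hkT
    refine ⟨ht1, ht2, ?_⟩
    rw [hD, hD]
    exact hkE
  -- (iii) integrate the counting function
  have h3 := sum_measureReal_le_of_card_filter_le (stdGaussian (EuclideanSpace ℝ (Fin s))) T Ev
    (fun k _ => hmeas k) _ h2
  calc (T.card : ℝ) * κ = ∑ _k ∈ T, κ := by rw [Finset.sum_const, nsmul_eq_mul]
    _ ≤ ∑ k ∈ T, (stdGaussian (EuclideanSpace ℝ (Fin s))).real (Ev k) := Finset.sum_le_sum h1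
    _ ≤ _ := by exact_mod_cast h3

/-- **Stub Rη of line `Sketch` (`stub_robustGen`): the Gaussian-pair inequalities at every ratio
`λ > 1` imply the robust-excursion count at every threshold `η ∈ (0, 1)`.**  Given positive zeros
`z₀ < z₁ < ⋯ < z_N` of `F = Σ aᵢgᵢ²` and a set `K` of indices `k` whose excursion `(z_k, z_{k+1})`
contains an `η`-robust point `t` (`η M(t) < |F(t)|`, `M = Σ|aᵢ|gᵢ²`), `|K| ≤ C · Σ|supp gᵢ|` with
`C = ⌈2/κ⌉₊ + 1`, `κ` the Gaussian-pair constant at the ratio `λ = (1 + η)/(1 - η)`: indices with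
`M(z_k) > 0` number at most `2S/κ` (`card_mul_le_of_goodGen`), and indices with `M(z_k) = 0` make
`z_k` a positive zero of a fixed genuinely occurring `g_{i₀}` (`a_{i₀} ≠ 0`, `g_{i₀} ≠ 0`, which
exists as `F ≠ 0`), hence number `< |supp g_{i₀}| ≤ S` by sparse Descartes. [folklore] -/
theorem stub_robustGen :
    (∀ lam : ℝ, 1 < lam → ∃ κ : ℝ, 0 < κ ∧ ∀ (n : ℕ) (U V : EuclideanSpace ℝ (Fin n)), inner ℝ U V = 0 → 0 < ‖U‖ →
      (‖U‖ = ‖V‖ →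
        (1 / 2 : ℝ) ≤ (stdGaussian (EuclideanSpace ℝ (Fin n))).real {c | inner ℝ c U ^ 2 < inner ℝ c V ^ 2}) ∧
      (lam * ‖V‖ ^ 2 ≤ ‖U‖ ^ 2 →
        1 / 2 + κ ≤ (stdGaussian (EuclideanSpace ℝ (Fin n))).real {c | inner ℝ c V ^ 2 < inner ℝ c U ^ 2})) →
    ∀ η : ℝ, 0 < η → η < 1 → ∃ C : ℕ, ∀ (s : ℕ) (a : Fin s → ℝ) (g : Fin s → ℝ[X]) (N : ℕ) (z : Fin (N + 1) → ℝ)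
      (K : Finset (Fin N)),
      StrictMono z → 0 < z 0 →
      (∀ k, (∑ i, Polynomial.C (a i) * g i ^ 2).eval (z k) = 0) →
      (∀ k ∈ K, ∃ t : ℝ, z k.castSucc < t ∧ t < z k.succ ∧
        η * (∑ i, Polynomial.C (|a i|) * g i ^ 2).eval t < |(∑ i, Polynomial.C (a i) * g i ^ 2).eval t|) →
      K.card ≤ C * ∑ i, (g i).support.card := by
  intro hGall η hη0 hη1
  obtain ⟨κ, hκ, hG⟩ := hGall ((1 + η) / (1 - η)) (one_lt_ratioGen hη0 hη1)
  refine ⟨⌈2 / κ⌉₊ + 1, fun s a g N z K hz hz0 hroot hK => ?_⟩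
  classical
  -- a robust point `t k` in every robust excursion
  choose! t ht using hK
  have hMnn : ∀ (x : ℝ) (i : Fin s), 0 ≤ (C (|a i|) * g i ^ 2).eval x := fun x i => by
    rw [eval_mul, eval_C, eval_pow]
    positivity
  rcases K.eq_empty_or_nonempty with rfl | ⟨k₀, hk₀⟩
  · simp
  -- `F ≠ 0`, so some square genuinely occurs
  obtain ⟨i₀, ha₀, hg₀⟩ : ∃ i, a i ≠ 0 ∧ g i ≠ 0 := by
    by_contra hno
    push Not at hno
    have hF0 : (∑ i, C (a i) * g i ^ 2) = 0 := Finset.sum_eq_zero fun i _ => by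
      by_cases hai : a i = 0
      · simp [hai]
      · simp [hno i hai]
    have h := (ht k₀ hk₀).2.2
    rw [hF0, eval_zero, abs_zero] at h
    have : 0 ≤ η * (∑ i, C (|a i|) * g i ^ 2).eval (t k₀) := by
      rw [eval_finsetSum]
      exact mul_nonneg hη0.le (Finset.sum_nonneg fun i _ => hMnn _ i)
    linarith
  -- GOOD indices (`M(z_k) > 0`): the Gaussian count
  obtain ⟨good, hgood_def⟩ : ∃ good : Fin N → Prop,
      ∀ k, good k ↔ 0 < (∑ i, C (|a i|) * g i ^ 2).eval (z k.castSucc) := ⟨_, fun _ => Iff.rfl⟩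
  have hgood : ((K.filter good).card : ℝ) * κ ≤ 2 * ∑ i, (g i).support.card :=
    card_mul_le_of_goodGen hη0.le hη1 hG a g z hz hz0 hroot t (K.filter good) fun k hk => by
      rw [Finset.mem_filter, hgood_def] at hk
      exact ⟨(ht k hk.1).1, (ht k hk.1).2.1, (ht k hk.1).2.2, hk.2⟩
  -- BAD indices (`M(z_k) = 0`): `z_k` is a positive zero of `g i₀`
  have hbad : (K.filter fun k => ¬ good k).card ≤ ∑ i, (g i).support.card := by
    calc (K.filter fun k => ¬ good k).card ≤ ((g i₀).roots.toFinset.filter (0 < ·)).card := by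
          refine Finset.card_le_card_of_injOn (fun k => z k.castSucc) (fun k hk => ?_) ?_
          · have hk' := Finset.mem_filter.mp (Finset.mem_coe.mp hk)
            rw [hgood_def, not_lt] at hk'
            have hM0 : ∑ i, (C (|a i|) * g i ^ 2).eval (z k.castSucc) = 0 :=
              le_antisymm (by rw [← eval_finsetSum]; exact hk'.2)
                (Finset.sum_nonneg fun i _ => hMnn _ i)
            rw [Finset.sum_eq_zero_iff_of_nonneg fun i _ => hMnn _ i] at hM0
            have hi := hM0 i₀ (Finset.mem_univ _)
            rw [eval_mul, eval_C, eval_pow, mul_eq_zero, abs_eq_zero,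
              pow_eq_zero_iff two_ne_zero] at hi
            simp only [Finset.coe_filter, Set.mem_setOf_eq, Multiset.mem_toFinset, mem_roots hg₀,
              IsRoot.def]
            exact ⟨hi.resolve_left ha₀, lt_of_lt_of_le hz0 (hz.monotone (Fin.zero_le _))⟩
          · intro k _ k' _ hkk'
            exact Fin.castSucc_injective _ (hz.injective hkk')
      _ ≤ (g i₀).support.card := (card_roots_toFinset_filter_pos_lt_card_support hg₀).le
      _ ≤ ∑ i, (g i).support.card :=
          Finset.single_le_sum (f := fun i => (g i).support.card) (fun i _ => Nat.zero_le _)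
            (Finset.mem_univ i₀)
  -- bookkeeping: `|K| = #good + #bad ≤ ⌈2/κ⌉₊ · S + S`
  set S : ℕ := ∑ i, (g i).support.card with hS
  have hgoodN : (K.filter good).card ≤ ⌈2 / κ⌉₊ * S := by
    have h1 : (2 / κ : ℝ) ≤ ⌈2 / κ⌉₊ := Nat.le_ceil _
    have h0 : (0 : ℝ) ≤ S := Nat.cast_nonneg _
    have h2 : ((K.filter good).card : ℝ) ≤ (⌈2 / κ⌉₊ : ℝ) * S := by
      rw [← le_div_iff₀ hκ] at hgood
      calc ((K.filter good).card : ℝ) ≤ 2 * (S : ℝ) / κ := hgood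
        _ = 2 / κ * S := by ring
        _ ≤ ⌈2 / κ⌉₊ * S := mul_le_mul_of_nonneg_right h1 h0
    exact_mod_cast h2
  calc K.card = (K.filter good).card + (K.filter fun k => ¬ good k).card :=
        (Finset.card_filter_add_card_filter_not good).symm
    _ ≤ ⌈2 / κ⌉₊ * S + S := add_le_add hgoodN hbad
    _ = (⌈2 / κ⌉₊ + 1) * S := by ring

end Summit.ValiantsHypothesis.ValiantsHypothesis.Theorems.SOSTauSOSTau
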